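import Summits.RiemannHypothesis.RiemannHypothesis.Theorems.IntegerScrewScrewPolyFloorLandauTailBlocks
import Summits.RiemannHypothesis.RiemannHypothesis.Theorems.IntegerScrewScrewPolyFloorLandauTailArith
import HarnessLib

/-!
# Route IntegerScrew — TailFloor: the high zeros pay a polynomial floor WITHOUT RH

Helper file for crux `IntegerScrew.ScrewPolyFloor` (stmt-RiemannHypothesis-15757): the RH-free half of
idea card `Cruxes/ScrewPolyFloor/Ideas/abscissa-blind-head.md` (crux-ideate k2), now a theorem
(`tailFloor`). In the unconditional expansion of the screw form on a balanced vector
(`hasSum_screwForm`: `∑_{2≤m,m'≤M} G(log m, log m') y_m y_m' = ∑_ρ m(ρ)(−Π_ρ)/s_ρ²`,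
`s_ρ = ρ − ½`, `Π_ρ = P_y(s_ρ)P_y(−s_ρ)`), the zeros ABOVE height `T₀ = M¹⁶` contribute at least
`(1/24)·(log M)/M¹⁶ · ∑ y_m²`, for every `M ≥ M₀` and every balanced real `y`:

  `(1/24) log M / M¹⁶ · ∑_{m ≤ M} y_m² ≤ y·S_M·y − Re ∑_{|Im ρ| ≤ M¹⁶} m(ρ)(−Π_ρ)/s_ρ²`.

So the crux's polynomial margin is carried UNCONDITIONALLY by the high zeros; the RH-content of the
rung `M` is entirely in the finite head `|Im ρ| ≤ M¹⁶` (under RH each head term is `≥ 0`, giving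
the crux at that rung; `HeadSign ⟺ RH` remains the open half). No zero is located horizontally:
Landau's formula (`landau_gonek_formula`), the window bound (`pairing_window_positive`), one block
(`screwBlock_lower`) and its arithmetic (`block_arith`, fine blocks `(V, V(1 + 1/K)]`, `K = 2560 M²`),
summed over the geometric blocks above `M¹⁶` and passed to the limit along `hasSum_screwForm`.
-/

noncomputable section

open Complex Finset Filter
open scoped Real Topology

-- the layout-mandated namespace repeats the summit name
set_option linter.dupNamespace false

namespace Summit.RiemannHypothesis.RiemannHypothesis.Theorems.IntegerScrewLandau

open Literature.NumberTheory.LFunctions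

/-- The count `N_±(T) = ∑_{|Im ρ| ≤ T} m(ρ)` on `zerosUpTo T` is `2N(T)` (`T ≥ 0`). [folklore] -/
theorem sum_order_zerosUpTo_eq {T : ℝ} (hT : 0 ≤ T) :
    ∑ ρ ∈ SchoenfeldBound.zerosUpTo T, (riemannZetaZeroOrder (ρ : ℂ) : ℝ) = 2 * zetaZeroCount T := by
  rw [sum_zerosUpTo_eq_sum_weilZeroIndex_real T (fun z ↦ (riemannZetaZeroOrder z : ℝ)),
    sum_order_eq_two_mul_zetaZeroCount hT]

set_option maxHeartbeats 1600000 in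
/-- **TailFloor (RH-free).** There are `c > 0` and `M₀` such that for every `M ≥ M₀` and every real
vector `y` on `[1, M]` with `∑_{m ≤ M} y_m = 0`,
`c·(log M)/M¹⁶·∑ y_m² ≤ (∑_{2≤m,m'≤M} G(log m, log m') y_m y_m') − Re ∑_{|Im ρ| ≤ M¹⁶} m(ρ)(−P_y(ρ−½)P_y(−(ρ−½)))/(ρ−½)²`
— the zeros above height `M¹⁶`, in the unconditional expansion of the screw form
(`hasSum_screwForm`), pay the polynomial floor `c log M/M¹⁶` with `c = 1/24`; no hypothesis on the
zeros of `ζ`. [folklore] -/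
theorem tailFloor :
    ∃ (c : ℝ) (M₀ : ℕ), 0 < c ∧ ∀ M : ℕ, M₀ ≤ M → ∀ y : ℕ → ℝ, ∑ m ∈ Icc 1 M, y m = 0 →
      c * Real.log M / (M : ℝ) ^ 16 * ∑ m ∈ Icc 1 M, y m ^ 2 ≤
        (∑ m ∈ Icc 2 M, ∑ m' ∈ Icc 2 M,
            zetaScrewKernel (Real.log m) (Real.log m') * (y m * y m')) -
          (∑ ρ ∈ SchoenfeldBound.zerosUpTo ((M : ℝ) ^ 16),
            (riemannZetaZeroOrder (ρ : ℂ) : ℂ) *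
              (-((∑ m ∈ Icc 1 M, ((y m : ℝ) : ℂ) * (m : ℂ) ^ ((ρ : ℂ) - 1 / 2)) *
                  ∑ m ∈ Icc 1 M, ((y m : ℝ) : ℂ) * (m : ℂ) ^ (-((ρ : ℂ) - 1 / 2))) /
                ((ρ : ℂ) - 1 / 2) ^ 2)).re := by
  obtain ⟨CP, TP, hCP0, hTP2, hpos⟩ := pairing_window_positive
  obtain ⟨CU, TU, hCU0, hTU2, hupper⟩ := zetaZeroCount_window_upper
  refine ⟨1 / 24, max (max 3 (⌈max TP TU⌉₊ + 1)) (max (⌈327680 * CP⌉₊ + 1) (⌈5120 * CU⌉₊ + 1)),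
    by norm_num, fun M hM y hy0 ↦ ?_⟩
  classical
  -- the size of `M`
  have hM3n : 3 ≤ M := le_trans (le_max_left _ _ |>.trans' (le_max_left _ _)) hM
  have hM1 : 1 ≤ M := le_trans (by norm_num) hM3n
  set Mr : ℝ := (M : ℝ) with hMr
  have hM3 : (3 : ℝ) ≤ Mr := by rw [hMr]; exact_mod_cast hM3n
  have hM0 : 0 < Mr := by linarith
  have hceil : ∀ {x : ℝ} {n : ℕ}, ⌈x⌉₊ + 1 ≤ n → x ≤ (n : ℝ) := fun {x n} h ↦ by
    have h1 : x ≤ ⌈x⌉₊ := Nat.le_ceil x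
    have h2 : ((⌈x⌉₊ + 1 : ℕ) : ℝ) ≤ n := by exact_mod_cast h
    push_cast at h2
    linarith
  have hTPM : max TP TU ≤ Mr := hceil ((le_max_right _ _).trans ((le_max_left _ _).trans hM))
  have hC1 : 327680 * CP ≤ Mr := hceil ((le_max_left _ _).trans ((le_max_right _ _).trans hM))
  have hC2 : 5120 * CU ≤ Mr := hceil ((le_max_right _ _).trans ((le_max_right _ _).trans hM))
  have hlogM : 1 ≤ Real.log Mr := by
    rw [Real.le_log_iff_exp_le hM0]
    have := Real.exp_one_lt_d9
    linarith
  have hlogM0 : 0 ≤ Real.log Mr := by linarith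
  -- the parameters
  set S : ℝ := ∑ m ∈ Icc 1 M, y m ^ 2 with hS
  have hS0 : 0 ≤ S := Finset.sum_nonneg fun _ _ ↦ sq_nonneg _
  set T₀ : ℝ := Mr ^ 16 with hT₀
  set K : ℕ := 2560 * M ^ 2 with hKn
  set Kr : ℝ := (K : ℝ) with hKr
  have hKr2560 : Kr = 2560 * Mr ^ 2 := by simp [hKr, hKn, hMr]
  have hK1 : 1 ≤ K := by rw [hKn]; nlinarith
  have hKr0 : 0 < Kr := by rw [hKr2560]; positivity
  set r : ℝ := 1 + 1 / Kr with hr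
  have hKrinv : 0 < 1 / Kr := by positivity
  have hr1 : 1 ≤ r := by rw [hr]; linarith
  have hr1' : 1 < r := by rw [hr]; linarith
  set U : ℕ → ℝ := fun k ↦ T₀ * r ^ k with hU
  have hT₀1 : 1 ≤ T₀ := one_le_pow₀ (by linarith)
  have hT₀0 : 0 < T₀ := by linarith
  have hUsucc : ∀ k, U (k + 1) = U k * (1 + 1 / Kr) := fun k ↦ by
    simp only [hU, pow_succ]; ring
  have hUmono : ∀ k, U k ≤ U (k + 1) := fun k ↦ by
    rw [hUsucc]
    have : 0 ≤ U k := by positivity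
    have : 0 ≤ U k * (1 / Kr) := by positivity
    nlinarith
  have hUmono' : Monotone U := monotone_nat_of_le_succ hUmono
  have hUge : ∀ k, T₀ ≤ U k := fun k ↦ by
    have := hUmono' (Nat.zero_le k); simpa [hU] using this
  have hTPT₀ : TP ≤ T₀ := by
    calc TP ≤ Mr := (le_max_left _ _).trans hTPM
      _ ≤ T₀ := by rw [hT₀]; exact le_self_pow₀ (by linarith) (by norm_num)
  have hTUT₀ : TU ≤ T₀ := by
    calc TU ≤ Mr := (le_max_right _ _).trans hTPM
      _ ≤ T₀ := by rw [hT₀]; exact le_self_pow₀ (by linarith) (by norm_num)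
  -- the summand and the expansion
  set F : NicolasJExplicit.Zeros → ℂ := fun ρ ↦ (riemannZetaZeroOrder (ρ : ℂ) : ℂ) *
    (-((∑ m ∈ Icc 1 M, ((y m : ℝ) : ℂ) * (m : ℂ) ^ ((ρ : ℂ) - 1 / 2)) *
        ∑ m ∈ Icc 1 M, ((y m : ℝ) : ℂ) * (m : ℂ) ^ (-((ρ : ℂ) - 1 / 2))) /
      ((ρ : ℂ) - 1 / 2) ^ 2) with hF
  set SF : ℝ := ∑ m ∈ Icc 2 M, ∑ m' ∈ Icc 2 M,
    zetaScrewKernel (Real.log m) (Real.log m') * (y m * y m') with hSF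
  have hsum : HasSum F (SF : ℂ) := hasSum_screwForm M hM1 y hy0
  set H : ℕ → ℂ := fun k ↦ ∑ ρ ∈ SchoenfeldBound.zerosUpTo (U k), F ρ with hH
  -- (i) the head sums converge to the screw form
  have hfin : Tendsto (fun k ↦ SchoenfeldBound.zerosUpTo (U k)) atTop atTop := by
    refine tendsto_atTop_finset_of_monotone (fun a b hab ↦ SchoenfeldBound.zerosUpTo_subset (hUmono' hab)) ?_
    intro ρ
    have hpow : Tendsto (fun k : ℕ ↦ r ^ k) atTop atTop := tendsto_pow_atTop_atTop_of_one_lt hr1'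
    obtain ⟨k, hk⟩ := (hpow.eventually_ge_atTop (|(ρ : ℂ).im| / T₀)).exists
    refine ⟨k, ?_⟩
    rw [SchoenfeldBound.mem_zerosUpTo]
    simp only [hU]
    rw [div_le_iff₀ hT₀0] at hk
    linarith
  have hlim : Tendsto H atTop (𝓝 (SF : ℂ)) := by
    have h := hsum
    rw [HasSum] at h
    simp only [SummationFilter.unconditional_filter] at h
    exact h.comp hfin
  -- (ii) one block
  have hblock : ∀ k : ℕ, Real.log (U k) / (128 * Kr * U k) * S ≤ (H (k + 1) - H k).re := by
    intro k
    set V : ℝ := U k with hV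
    have hVT : T₀ ≤ V := hUge k
    have hV16 : Mr ^ 16 ≤ V := hVT
    have hVTP : TP ≤ V := hTPT₀.trans hVT
    have hVTU : TU ≤ V := hTUT₀.trans hVT
    have hV0 : 0 < V := by linarith
    have hVW : V ≤ V * (1 + 1 / Kr) := by
      have : 0 ≤ V * (1 / Kr) := by positivity
      nlinarith
    -- the block sum
    have hsub : SchoenfeldBound.zerosUpTo V ⊆ SchoenfeldBound.zerosUpTo (V * (1 + 1 / Kr)) :=
      SchoenfeldBound.zerosUpTo_subset hVW
    have hHdiff : H (k + 1) - H k = ∑ ρ ∈ SchoenfeldBound.zerosUpTo (V * (1 + 1 / Kr)) \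
        SchoenfeldBound.zerosUpTo V, F ρ := by
      simp only [hH]
      rw [hUsucc k, Finset.sum_sdiff_eq_sub hsub]
    -- the block lower bound
    have hB := screwBlock_lower (C := CP) hTP2 hpos hM1 y hVTP hVW
    -- the count in the block
    set ΔN : ℝ := (∑ ρ ∈ SchoenfeldBound.zerosUpTo (V * (1 + 1 / Kr)), (riemannZetaZeroOrder (ρ : ℂ) : ℝ)) -
      ∑ ρ ∈ SchoenfeldBound.zerosUpTo V, (riemannZetaZeroOrder (ρ : ℂ) : ℝ) with hΔN
    have hΔNeq : ΔN = 2 * zetaZeroCount (V * (1 + 1 / Kr)) - 2 * zetaZeroCount V := by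
      rw [hΔN, sum_order_zerosUpTo_eq (by positivity), sum_order_zerosUpTo_eq hV0.le]
    have hΔNle : ΔN ≤ 2 * ((V * (1 + 1 / Kr) - V) / (2 * π) * Real.log (V * (1 + 1 / Kr) / (2 * π)) +
        CU * Real.log (V * (1 + 1 / Kr))) := by
      rw [hΔNeq]
      have h := hupper V (V * (1 + 1 / Kr)) hVTU hVW
      linarith
    -- the arithmetic
    have hA := block_arith (CU := CU) (ΔN := ΔN) hCP0.le hM3 hlogM hKr2560 hV16 hC1 hC2 hΔNle
    rw [hHdiff]
    refine le_trans ?_ hB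
    exact mul_le_mul_of_nonneg_right hA hS0
  -- nonnegativity and the size of the first `K` blocks
  have hblock0 : ∀ k : ℕ, 0 ≤ (H (k + 1) - H k).re := fun k ↦ by
    refine le_trans ?_ (hblock k)
    have : 0 ≤ Real.log (U k) := Real.log_nonneg (hT₀1.trans (hUge k))
    have : 0 < U k := lt_of_lt_of_le hT₀0 (hUge k)
    positivity
  have hblockK : ∀ k : ℕ, k < K → Real.log Mr / (24 * Kr * T₀) * S ≤ (H (k + 1) - H k).re := by
    intro k hk
    refine le_trans ?_ (hblock k)
    refine mul_le_mul_of_nonneg_right ?_ hS0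
    have hUk3 : U k ≤ 3 * T₀ := by
      have h := one_add_inv_pow_le_three hK1 hk.le
      rw [← hKr] at h
      have h' : r ^ k ≤ 3 := by rw [hr]; exact h
      calc U k = T₀ * r ^ k := rfl
        _ ≤ T₀ * 3 := mul_le_mul_of_nonneg_left h' hT₀0.le
        _ = 3 * T₀ := by ring
    have hUk0 : 0 < U k := lt_of_lt_of_le hT₀0 (hUge k)
    have hlogUk : 16 * Real.log Mr ≤ Real.log (U k) := by
      have e : Real.log T₀ = 16 * Real.log Mr := by rw [hT₀, Real.log_pow]; norm_num
      rw [← e]; exact Real.log_le_log hT₀0 (hUge k)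
    rw [div_le_div_iff₀ (by positivity) (by positivity)]
    calc Real.log Mr * (128 * Kr * U k) ≤ Real.log Mr * (128 * Kr * (3 * T₀)) := by gcongr
      _ = 16 * Real.log Mr * (24 * Kr * T₀) := by ring
      _ ≤ Real.log (U k) * (24 * Kr * T₀) := by gcongr
  -- (iii) the partial sums
  have hpartial : ∀ n : ℕ, K ≤ n → Real.log Mr / (24 * T₀) * S ≤ (H n - H 0).re := by
    intro n hn
    have htel : H n - H 0 = ∑ k ∈ Finset.range n, (H (k + 1) - H k) :=
      (Finset.sum_range_sub H n).symm
    rw [htel, Complex.re_sum]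
    calc Real.log Mr / (24 * T₀) * S = ∑ k ∈ Finset.range K, Real.log Mr / (24 * Kr * T₀) * S := by
          rw [Finset.sum_const, Finset.card_range, nsmul_eq_mul, ← hKr]
          field_simp
      _ ≤ ∑ k ∈ Finset.range K, (H (k + 1) - H k).re :=
          Finset.sum_le_sum fun k hk ↦ hblockK k (Finset.mem_range.1 hk)
      _ ≤ ∑ k ∈ Finset.range n, (H (k + 1) - H k).re :=
          Finset.sum_le_sum_of_subset_of_nonneg (Finset.range_mono hn) fun k _ _ ↦ hblock0 k
  -- (iv) the limit
  have hlimre : Tendsto (fun n ↦ (H n - H 0).re) atTop (𝓝 (((SF : ℂ) - H 0).re)) :=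
    (Complex.continuous_re.tendsto _).comp (hlim.sub_const (H 0))
  have hge : Real.log Mr / (24 * T₀) * S ≤ ((SF : ℂ) - H 0).re :=
    ge_of_tendsto hlimre (Filter.eventually_atTop.2 ⟨K, hpartial⟩)
  -- rewrite the conclusion
  have hH0 : H 0 = ∑ ρ ∈ SchoenfeldBound.zerosUpTo ((M : ℝ) ^ 16), F ρ := by
    simp only [hH, hU, hT₀, hMr, pow_zero, mul_one]
  rw [Complex.sub_re, Complex.ofReal_re, hH0] at hge
  have e : 1 / 24 * Real.log M / (M : ℝ) ^ 16 * S = Real.log Mr / (24 * T₀) * S := by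
    simp only [hMr, hT₀]; field_simp
  rw [e]
  exact hge

end Summit.RiemannHypothesis.RiemannHypothesis.Theorems.IntegerScrewLandau

end
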